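import Summits.CriticalPhenomena.PercolationContinuityZ3.Theorems.Transplant.BoxProdZ2StepKits
import Summits.CriticalPhenomena.PercolationContinuityZ3.Theorems.Transplant.BoxProdZ2CenterRouteMono
import HarnessLib

/-!
# The `X □ ℤ²` route lemmas AT A RUNNING PARAMETER `q` (two-parameter forms of `deep_h3`, `hcon_of_room`, `link_frameSeq_center`,
# `link_seed_center` and their monotone-law forms `_of_le`)

builds on p205010 (kernel theorem, internal audit signed; external expert review pending) — nothing in this file uses p205010.
Lane `prim-bschramm`, seat `prim-bschramm-p3` (order I3 of V56: expose the θ-inputs at the RUNNING parameter); helper file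
(`--supports stmt-CriticalPhenomena-4575 --as helper`).

Design (D) re-runs the construction at `q₀ < p` (ENTRY-SEED-STAR.md §10–§11): the geometry (fat radius `ψ`, fat prisms, kit cubes, frame
sequences) stays the one built from `hT : TubeSubcritical X p₀` at `p₀ = p`, while every measure — the standard estimates `hstd`/`hlink`, the
subbox weighting `IsSubbox … Wt q D`, the seed arithmetic `(1 - q^{sB})^k` and the conclusions — is at the running parameter `q`.  The landed
one-parameter lemmas tie both to the same `p`; these are their verbatim two-parameter copies (proofs unchanged: no step uses `q = p₀`).

[cite: KozmaNitzan2024, §4 Lemma 9 (p. 16), Lemma 11 (p. 23), p. 21 ((24)–(25)) — the ℤ^d model] [cite: GrimmettPercolation1999, §7.2]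
-/

noncomputable section

open MeasureTheory

namespace Summit.CriticalPhenomena.PercolationContinuityZ3.Theorems

namespace Transplant

namespace BoxProdZ2

open Literature.Probability.Percolation Literature.Probability.LatticeModels SimpleGraph KNLevels KozmaNitzan
open Literature.Probability.Percolation.GM
open Literature.Barriers.CriticalPhenomena (graphBall graphBall_finite mem_graphBall_self graphBall_mono)
open scoped Classical

variable {W : Type} [DecidableEq W] (X : SimpleGraph W) [X.LocallyFinite]

/-- (Two-parameter form: geometry `ψ = ufatRadius X hT V₀` from `hT` at `p₀`, measure at `q`.) **The deep-contact target route.**  For `ℓ > M`, the link clause of the standard estimates AT SCALE `ℓ`, a subbox weighting `Wt` of the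
tube graph on `D`, a frame `γ` of the contact with `γ c ∈ V₀`, and `Λˣ_ℓ ⊆ D` with fibres in the window: the fat orthant face `Ft` of scale
`ℓ` satisfies `Ft ⊆ Λˣ_ℓ`, `Ft ∩ kitCube x = ∅`, and `1 - δ² < P_{Wt}(linkIn Λˣ_ℓ (Λˣ (msel τ)) Ft)` — the `h3` input of `kit_hIVQ` /
`kitClauseQ` with `Qt := Λˣ_ℓ`. [cite: KozmaNitzan2024, §4 q. 16 (hittable), Lemma 9, q. 21 ((24)–(25))] -/
theorem deep_h3Q [Countable W] {p₀ : unitInterval} (hT : TubeSubcritical X p₀) {q : unitInterval} (V₀ : Finset W) {δ : ℝ} {msel : W → ℕ} {M ℓ : ℕ}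
    (hMℓ : M < ℓ)
    (hlink : ∀ τ ∈ V₀, ∀ g : HOct 2, 1 - δ ^ 2 < (bondPercolation (X □ zdGraph 2) q).real
      (linkIn (↑(ufatSeq X hT V₀ τ ℓ)) (ufatSeq X hT V₀ τ (msel τ)) (ballFin X τ (ufatRadius X hT V₀ ℓ) ×ˢ piece g ℓ)))
    {xe : W} {Rw : ℕ} {Lo Hi : Site 2} {Wt : Sym2 (W × Site 2) → unitInterval} {D : Finset (W × Site 2)}
    (hWD : IsSubbox (tubeGraph X (ballFin X xe Rw)) Wt q D) {x : W × Site 2} (γ : X ≃g X)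
    (hγ : γ (fibCtrT X xe Rw (ufatRadius X hT V₀ M) x.1) ∈ V₀)
    (hQD : frameSeq X hT V₀ γ (vctr Lo Hi M (pwin Lo Hi M x.2).1 (pwin Lo Hi M x.2).2.1 (pwin Lo Hi M x.2).2.2)
      (γ (fibCtrT X xe Rw (ufatRadius X hT V₀ M) x.1)) ℓ ⊆ D)
    (hQπ : ∀ u ∈ frameSeq X hT V₀ γ (vctr Lo Hi M (pwin Lo Hi M x.2).1 (pwin Lo Hi M x.2).2.1 (pwin Lo Hi M x.2).2.2)
      (γ (fibCtrT X xe Rw (ufatRadius X hT V₀ M) x.1)) ℓ, u.1 ∈ ballFin X xe Rw)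
    (a : Fin 2) (τ' : Fin 2 → ℤˣ) :
    let v := vctr Lo Hi M (pwin Lo Hi M x.2).1 (pwin Lo Hi M x.2).2.1 (pwin Lo Hi M x.2).2.2
    let τ := γ (fibCtrT X xe Rw (ufatRadius X hT V₀ M) x.1)
    let Ft := (ballFin X τ (ufatRadius X hT V₀ ℓ) ×ˢ orthantFace a τ' ℓ).image (prodFrameIso X γ.symm v)
    Ft ⊆ frameSeq X hT V₀ γ v τ ℓ ∧ Disjoint Ft (kitCube X xe Rw Lo Hi M (ufatRadius X hT V₀ M) x) ∧
      1 - δ ^ 2 < (prodBernoulli Wt).real (linkIn (↑(frameSeq X hT V₀ γ v τ ℓ)) (frameSeq X hT V₀ γ v τ (msel τ)) Ft) := by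
  intro v τ Ft
  refine ⟨fatOrthantFace_subset_frameSeq X hT V₀ γ v τ ℓ a τ', disjoint_fatOrthantFace_kitCube X _ γ hMℓ a τ' xe Rw _ Lo Hi x, ?_⟩
  rw [real_cubeEvent_eq X hWD hQD hQπ (determinedBy_linkIn _ _ _ le_rfl) (measurableSet_linkIn _ _ _)]
  have h := real_linkIn_image_iso (G := X □ zdGraph 2) (prodFrameIso X γ.symm v) q (ufatSeq X hT V₀ τ ℓ) (ufatSeq X hT V₀ τ (msel τ))
    (ballFin X τ (ufatRadius X hT V₀ ℓ) ×ˢ orthantFace a τ' ℓ)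
  change 1 - δ ^ 2 < (bondPercolation (X □ zdGraph 2) q).real (linkIn (↑((ufatSeq X hT V₀ τ ℓ).image (prodFrameIso X γ.symm v)))
    ((ufatSeq X hT V₀ τ (msel τ)).image (prodFrameIso X γ.symm v))
    ((ballFin X τ (ufatRadius X hT V₀ ℓ) ×ˢ orthantFace a τ' ℓ).image (prodFrameIso X γ.symm v)))
  rw [h, product_orthantFace_eq_piece]
  exact hlink τ hγ _

/-- (Two-parameter form: geometry `ψ = ufatRadius X hT V₀` from `hT` at `p₀`, measure at `q`.) **The deep branch of `kitClauseQ`'s per-contact dichotomy, from a planar room and fibre deepness.**  Inputs: the link estimate of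
`exists_scales` at scale `ℓ > M` (`hlink`), a subbox weighting `Wt` of the tube graph over `π = B_X(xe, Rw)` on `D = π × Dpl`, a target
`T ⊇ π × Tpl`, a candidate contact `x` of the level `π × Icc (lo - j) (hi + j)` with frame `γ` (`γ c_x ∈ V₀`), DEEPNESS `B_X(c_x, ψ ℓ) ⊆ π`, and the
ROOM at its cube centre `v`: `v + Λ_ℓ ⊆ Dpl` and `v + orthantFace a τ' ℓ ⊆ Tpl`.  Output: the `∃ γ Qt Ft, …` disjunct of `kitClauseQ`'s `hcon`.
[cite: KozmaNitzan2024, §4 Lemma 11 (q. 23), q. 21 ((24)–(25))] -/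
theorem hcon_of_roomQ [Countable W] {p₀ : unitInterval} (hT : TubeSubcritical X p₀) {q : unitInterval} (V₀ : Finset W) {δ : ℝ} {msel : W → ℕ} {M ℓ : ℕ}
    (hMℓ : M < ℓ)
    (hlink : ∀ τ ∈ V₀, ∀ g : HOct 2, 1 - δ ^ 2 < (bondPercolation (X □ zdGraph 2) q).real
      (linkIn (↑(ufatSeq X hT V₀ τ ℓ)) (ufatSeq X hT V₀ τ (msel τ)) (ballFin X τ (ufatRadius X hT V₀ ℓ) ×ˢ piece g ℓ)))
    {xe : W} {Rw : ℕ} {lo hi : Site 2} {j : ℕ} {Wt : Sym2 (W × Site 2) → unitInterval} {Dpl Tpl : Finset (Site 2)}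
    {T : Finset (W × Site 2)} (hWD : IsSubbox (tubeGraph X (ballFin X xe Rw)) Wt q (ballFin X xe Rw ×ˢ Dpl))
    (hTsub : ballFin X xe Rw ×ˢ Tpl ⊆ T) {x : W × Site 2} (γ : X ≃g X) (hγ : γ (fibCtrT X xe Rw (ufatRadius X hT V₀ M) x.1) ∈ V₀)
    (hdeep : ballFin X (fibCtrT X xe Rw (ufatRadius X hT V₀ M) x.1) (ufatRadius X hT V₀ ℓ) ⊆ ballFin X xe Rw)
    (hroomD : (box 2 ℓ).image (fun t => t + vctr (lo - ((j : ℕ) : Site 2)) (hi + ((j : ℕ) : Site 2)) M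
      (pwin (lo - ((j : ℕ) : Site 2)) (hi + ((j : ℕ) : Site 2)) M x.2).1 (pwin (lo - ((j : ℕ) : Site 2)) (hi + ((j : ℕ) : Site 2)) M x.2).2.1
      (pwin (lo - ((j : ℕ) : Site 2)) (hi + ((j : ℕ) : Site 2)) M x.2).2.2) ⊆ Dpl)
    {a : Fin 2} {τ' : Fin 2 → ℤˣ}
    (hroomT : (orthantFace a τ' ℓ).image (fun t => t + vctr (lo - ((j : ℕ) : Site 2)) (hi + ((j : ℕ) : Site 2)) M
      (pwin (lo - ((j : ℕ) : Site 2)) (hi + ((j : ℕ) : Site 2)) M x.2).1 (pwin (lo - ((j : ℕ) : Site 2)) (hi + ((j : ℕ) : Site 2)) M x.2).2.1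
      (pwin (lo - ((j : ℕ) : Site 2)) (hi + ((j : ℕ) : Site 2)) M x.2).2.2) ⊆ Tpl) :
    ∃ (γ' : X ≃g X) (Qt Ft : Finset (W × Site 2)), γ' (fibCtrT X xe Rw (ufatRadius X hT V₀ M) x.1) ∈ V₀ ∧ Ft ⊆ T ∧ Qt ⊆ ballFin X xe Rw ×ˢ Dpl ∧
      Disjoint Ft (kitCube X xe Rw (lo - ((j : ℕ) : Site 2)) (hi + ((j : ℕ) : Site 2)) M (ufatRadius X hT V₀ M) x) ∧
      1 - δ ^ 2 < (prodBernoulli Wt).real (linkIn (↑Qt)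
        (frameSeq X hT V₀ γ' (vctr (lo - ((j : ℕ) : Site 2)) (hi + ((j : ℕ) : Site 2)) M
          (pwin (lo - ((j : ℕ) : Site 2)) (hi + ((j : ℕ) : Site 2)) M x.2).1 (pwin (lo - ((j : ℕ) : Site 2)) (hi + ((j : ℕ) : Site 2)) M x.2).2.1
          (pwin (lo - ((j : ℕ) : Site 2)) (hi + ((j : ℕ) : Site 2)) M x.2).2.2) (γ' (fibCtrT X xe Rw (ufatRadius X hT V₀ M) x.1))
          (msel (γ' (fibCtrT X xe Rw (ufatRadius X hT V₀ M) x.1)))) Ft) := by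
  set v := vctr (lo - ((j : ℕ) : Site 2)) (hi + ((j : ℕ) : Site 2)) M (pwin (lo - ((j : ℕ) : Site 2)) (hi + ((j : ℕ) : Site 2)) M x.2).1
    (pwin (lo - ((j : ℕ) : Site 2)) (hi + ((j : ℕ) : Site 2)) M x.2).2.1 (pwin (lo - ((j : ℕ) : Site 2)) (hi + ((j : ℕ) : Site 2)) M x.2).2.2 with hv
  set c := fibCtrT X xe Rw (ufatRadius X hT V₀ M) x.1 with hc
  have hQD : frameSeq X hT V₀ γ v (γ c) ℓ ⊆ ballFin X xe Rw ×ˢ Dpl := frameSeq_subset_of_room X hT V₀ γ hdeep hroomD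
  have hQπ : ∀ u ∈ frameSeq X hT V₀ γ v (γ c) ℓ, u.1 ∈ ballFin X xe Rw := fun u hu => (Finset.mem_product.1 (hQD hu)).1
  obtain ⟨hFQ, hdisj, h3⟩ := deep_h3Q X hT V₀ hMℓ hlink (Lo := lo - ((j : ℕ) : Site 2)) (Hi := hi + ((j : ℕ) : Site 2)) hWD γ hγ hQD hQπ a τ'
  refine ⟨γ, frameSeq X hT V₀ γ v (γ c) ℓ, _, hγ, ?_, hQD, hdisj, h3⟩
  exact (fatFace_subset_of_room X hT V₀ γ hdeep hroomT).trans hTsub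

/-- (Two-parameter form: geometry `ψ = ufatRadius X hT V₀` from `hT` at `p₀`, measure at `q`.) **The first hop from a centred seed** (Lemma 9-prod at the centre, transported): for a centre `c`, frame `γ'` with `γ' c ∈ V₀`, planar centre
`v`, scale `ℓ`, the link clause of `exists_scales` at scale `ℓ`, a subbox weighting `Wt` of the tube graph over `π = B_X(xe, Rw)` on `D`, and
`frameSeq ℓ ⊆ D` with fibres in `π`: the inner fat prism is linked inside the prism of scale `ℓ` to the fat orthant face `(a, τ')` with
`P_{Wt} > 1 - δ²`. [cite: KozmaNitzan2024, §4 Lemma 9 (q. 16), q. 23] -/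
theorem link_frameSeq_centerQ [Countable W] {p₀ : unitInterval} (hT : TubeSubcritical X p₀) {q : unitInterval} (V₀ : Finset W) {δ : ℝ} {msel : W → ℕ} {ℓ : ℕ}
    (hlink : ∀ τ ∈ V₀, ∀ g : HOct 2, 1 - δ ^ 2 < (bondPercolation (X □ zdGraph 2) q).real
      (linkIn (↑(ufatSeq X hT V₀ τ ℓ)) (ufatSeq X hT V₀ τ (msel τ)) (ballFin X τ (ufatRadius X hT V₀ ℓ) ×ˢ piece g ℓ)))
    {xe : W} {Rw : ℕ} {Wt : Sym2 (W × Site 2) → unitInterval} {D : Finset (W × Site 2)}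
    (hWD : IsSubbox (tubeGraph X (ballFin X xe Rw)) Wt q D) {c : W} (γ' : X ≃g X) (hγ : γ' c ∈ V₀) (v : Site 2)
    (hQD : frameSeq X hT V₀ γ' v (γ' c) ℓ ⊆ D) (hQπ : ∀ u ∈ frameSeq X hT V₀ γ' v (γ' c) ℓ, u.1 ∈ ballFin X xe Rw)
    (a : Fin 2) (τ' : Fin 2 → ℤˣ) :
    1 - δ ^ 2 < (prodBernoulli Wt).real (linkIn (↑(frameSeq X hT V₀ γ' v (γ' c) ℓ)) (frameSeq X hT V₀ γ' v (γ' c) (msel (γ' c)))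
      ((ballFin X (γ' c) (ufatRadius X hT V₀ ℓ) ×ˢ orthantFace a τ' ℓ).image (prodFrameIso X γ'.symm v))) := by
  set τ := γ' c with hτ
  rw [real_cubeEvent_eq X hWD hQD hQπ (determinedBy_linkIn _ _ _ le_rfl) (measurableSet_linkIn _ _ _)]
  have h := real_linkIn_image_iso (G := X □ zdGraph 2) (prodFrameIso X γ'.symm v) q (ufatSeq X hT V₀ τ ℓ) (ufatSeq X hT V₀ τ (msel τ))
    (ballFin X τ (ufatRadius X hT V₀ ℓ) ×ˢ orthantFace a τ' ℓ)
  change 1 - δ ^ 2 < (bondPercolation (X □ zdGraph 2) q).real (linkIn (↑((ufatSeq X hT V₀ τ ℓ).image (prodFrameIso X γ'.symm v)))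
    ((ufatSeq X hT V₀ τ (msel τ)).image (prodFrameIso X γ'.symm v))
    ((ballFin X τ (ufatRadius X hT V₀ ℓ) ×ˢ orthantFace a τ' ℓ).image (prodFrameIso X γ'.symm v)))
  rw [h, product_orthantFace_eq_piece]
  exact hlink τ hγ _

/-- (Two-parameter form: geometry `ψ = ufatRadius X hT V₀` from `hT` at `p₀`, measure at `q`.) **From a (wired) seed containing the inner fat prism to a target containing the fat face**: monotone corollary of `link_frameSeq_centerQ`
(`linkIn` grows with the source and target sets). [cite: KozmaNitzan2024, §4 Lemma 11 (q. 23)] -/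
theorem link_seed_centerQ [Countable W] {p₀ : unitInterval} (hT : TubeSubcritical X p₀) {q : unitInterval} (V₀ : Finset W) {δ : ℝ} {msel : W → ℕ} {ℓ : ℕ}
    (hlink : ∀ τ ∈ V₀, ∀ g : HOct 2, 1 - δ ^ 2 < (bondPercolation (X □ zdGraph 2) q).real
      (linkIn (↑(ufatSeq X hT V₀ τ ℓ)) (ufatSeq X hT V₀ τ (msel τ)) (ballFin X τ (ufatRadius X hT V₀ ℓ) ×ˢ piece g ℓ)))
    {xe : W} {Rw : ℕ} {Wt : Sym2 (W × Site 2) → unitInterval} {D : Finset (W × Site 2)}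
    (hWD : IsSubbox (tubeGraph X (ballFin X xe Rw)) Wt q D) {c : W} (γ' : X ≃g X) (hγ : γ' c ∈ V₀) (v : Site 2)
    (hQD : frameSeq X hT V₀ γ' v (γ' c) ℓ ⊆ D) (hQπ : ∀ u ∈ frameSeq X hT V₀ γ' v (γ' c) ℓ, u.1 ∈ ballFin X xe Rw)
    (a : Fin 2) (τ' : Fin 2 → ℤˣ) {Sd T : Finset (W × Site 2)} (hSd : frameSeq X hT V₀ γ' v (γ' c) (msel (γ' c)) ⊆ Sd)
    (hTt : (ballFin X (γ' c) (ufatRadius X hT V₀ ℓ) ×ˢ orthantFace a τ' ℓ).image (prodFrameIso X γ'.symm v) ⊆ T) :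
    1 - δ ^ 2 < (prodBernoulli Wt).real (linkIn (↑(frameSeq X hT V₀ γ' v (γ' c) ℓ)) Sd T) :=
  (link_frameSeq_centerQ X hT V₀ hlink hWD γ' hγ v hQD hQπ a τ').trans_le
    (measureReal_mono (linkIn_mono le_rfl hSd hTt) (measure_ne_top _ _))

/-- (Two-parameter form: geometry `ψ = ufatRadius X hT V₀` from `hT` at `p₀`, measure at `q`.) **The first hop from a centred seed, monotone form**: for a centre `c`, frame `γ'` with `γ' c ∈ V₀`, planar centre `v`, scale `ℓ`, the
link clause of `exists_scales` at scale `ℓ`, and ANY weighting `Wt` with `q ≤ Wt` on the edges of `X □ ℤ²` inside `frameSeq ℓ`: the inner fat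
prism is linked inside the prism of scale `ℓ` to the fat orthant face `(a, τ')` with `P_{Wt} > 1 - δ²`. [cite: KozmaNitzan2024, §4 Lemma 9 (q. 16), q. 23] -/
theorem link_frameSeq_center_of_leQ [Countable W] {p₀ : unitInterval} (hT : TubeSubcritical X p₀) {q : unitInterval} (V₀ : Finset W) {δ : ℝ} {msel : W → ℕ} {ℓ : ℕ}
    (hlink : ∀ τ ∈ V₀, ∀ g : HOct 2, 1 - δ ^ 2 < (bondPercolation (X □ zdGraph 2) q).real
      (linkIn (↑(ufatSeq X hT V₀ τ ℓ)) (ufatSeq X hT V₀ τ (msel τ)) (ballFin X τ (ufatRadius X hT V₀ ℓ) ×ˢ piece g ℓ)))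
    {Wt : Sym2 (W × Site 2) → unitInterval} {c : W} (γ' : X ≃g X) (hγ : γ' c ∈ V₀) (v : Site 2)
    (hge : ∀ u ∈ frameSeq X hT V₀ γ' v (γ' c) ℓ, ∀ u' ∈ frameSeq X hT V₀ γ' v (γ' c) ℓ, (X □ zdGraph 2).Adj u u' → q ≤ Wt s(u, u'))
    (a : Fin 2) (τ' : Fin 2 → ℤˣ) :
    1 - δ ^ 2 < (prodBernoulli Wt).real (linkIn (↑(frameSeq X hT V₀ γ' v (γ' c) ℓ)) (frameSeq X hT V₀ γ' v (γ' c) (msel (γ' c)))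
      ((ballFin X (γ' c) (ufatRadius X hT V₀ ℓ) ×ˢ orthantFace a τ' ℓ).image (prodFrameIso X γ'.symm v))) := by
  set τ := γ' c with hτ
  refine lt_of_lt_of_le ?_ (real_ge_bondPercolation_of_le X hge (isUpperSet_linkIn' _ _ _) (determinedBy_linkIn _ _ _ le_rfl)
    (measurableSet_linkIn _ _ _))
  have h := real_linkIn_image_iso (G := X □ zdGraph 2) (prodFrameIso X γ'.symm v) q (ufatSeq X hT V₀ τ ℓ) (ufatSeq X hT V₀ τ (msel τ))
    (ballFin X τ (ufatRadius X hT V₀ ℓ) ×ˢ orthantFace a τ' ℓ)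
  change 1 - δ ^ 2 < (bondPercolation (X □ zdGraph 2) q).real (linkIn (↑((ufatSeq X hT V₀ τ ℓ).image (prodFrameIso X γ'.symm v)))
    ((ufatSeq X hT V₀ τ (msel τ)).image (prodFrameIso X γ'.symm v))
    ((ballFin X τ (ufatRadius X hT V₀ ℓ) ×ˢ orthantFace a τ' ℓ).image (prodFrameIso X γ'.symm v)))
  rw [h, product_orthantFace_eq_piece]
  exact hlink τ hγ _

/-- (Two-parameter form: geometry `ψ = ufatRadius X hT V₀` from `hT` at `p₀`, measure at `q`.) **From a wired seed containing the inner fat prism to a target containing the fat face, monotone form.** [cite: KozmaNitzan2024, §4 Lemma 11 (q. 23)] -/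
theorem link_seed_center_of_leQ [Countable W] {p₀ : unitInterval} (hT : TubeSubcritical X p₀) {q : unitInterval} (V₀ : Finset W) {δ : ℝ} {msel : W → ℕ} {ℓ : ℕ}
    (hlink : ∀ τ ∈ V₀, ∀ g : HOct 2, 1 - δ ^ 2 < (bondPercolation (X □ zdGraph 2) q).real
      (linkIn (↑(ufatSeq X hT V₀ τ ℓ)) (ufatSeq X hT V₀ τ (msel τ)) (ballFin X τ (ufatRadius X hT V₀ ℓ) ×ˢ piece g ℓ)))
    {Wt : Sym2 (W × Site 2) → unitInterval} {c : W} (γ' : X ≃g X) (hγ : γ' c ∈ V₀) (v : Site 2)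
    (hge : ∀ u ∈ frameSeq X hT V₀ γ' v (γ' c) ℓ, ∀ u' ∈ frameSeq X hT V₀ γ' v (γ' c) ℓ, (X □ zdGraph 2).Adj u u' → q ≤ Wt s(u, u'))
    (a : Fin 2) (τ' : Fin 2 → ℤˣ) {Sd T : Finset (W × Site 2)} (hSd : frameSeq X hT V₀ γ' v (γ' c) (msel (γ' c)) ⊆ Sd)
    (hTt : (ballFin X (γ' c) (ufatRadius X hT V₀ ℓ) ×ˢ orthantFace a τ' ℓ).image (prodFrameIso X γ'.symm v) ⊆ T) :
    1 - δ ^ 2 < (prodBernoulli Wt).real (linkIn (↑(frameSeq X hT V₀ γ' v (γ' c) ℓ)) Sd T) :=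
  (link_frameSeq_center_of_leQ X hT V₀ hlink γ' hγ v hge a τ').trans_le
    (measureReal_mono (linkIn_mono le_rfl hSd hTt) (measure_ne_top _ _))

end BoxProdZ2

end Transplant

end Summit.CriticalPhenomena.PercolationContinuityZ3.Theorems

end
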